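import Summits.KontsevichZagierPeriods.KontsevichZagierPeriods.Theorems.LiouvilleUnfoldingLogPrimitiveNLStubCellwiseFoldAux

/-!
# Cellwise fold for `LogPrimitiveNL` (line `logderiv-peeling`), part 2: the stub `stub_cellwiseFold`

The stub `stub_cellwiseFold` of the lead's skeleton for crux `LogPrimitiveNL`
(stmt-KontsevichZagierPeriods-2836, line `logderiv-peeling`), proved from its antecedent (the cone
decomposition, another stub) inside the honest four-move Kontsevich–Zagier calculus:

* `fold_sum_of_mem_relations_piece` — on one chart piece, `Σᵢ [Vᵢ] ∈ KZ.relations` by the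
  power rule, peeling (`fold_of_sub_sum_mem_relations_peel`), regrouping of the integrands
  `(Σᵢ A i l hᵢ)/u = 0`, and integer division (`mem_relations_of_nsmul_mem_relations`);
* `fold_sum_of_mem_relations_cell` — on one cell, the cone decomposition applied to
  `ℓ = log W(x)` yields finitely many `ℚ`-semialgebraic chart pieces covering the cell; domain
  additivity over the (disjointified) pieces;
* `stub_cellwiseFold` — domain additivity over the cells (the remainder is null) and the cell case.

Every intermediate `KZ.IntegralRep` is absolutely integrable (dominated by `N |hᵢ| log Wᵢ`).
-/

noncomputable section

open Set MeasureTheory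
open Literature.NumberTheory.Transcendental Literature.ModelTheory.ExponentialFields

namespace Summit.KontsevichZagierPeriods.LiouvilleUnfolding.LogPrimitiveNL


/-- **The fold on one chart piece.** On a `ℚ`-semialgebraic `P` let `hᵢ`, `Wᵢ ≥ 1` be
`ℚ`-semialgebraic with `hᵢ log Wᵢ ∈ L¹(P)` and honest unfolded monomials
`Vᵢ = [{x ∈ P, 1 ≤ u ≤ Wᵢ x}, hᵢ x/u]`; suppose given chart data: `N₀ ≥ 1`, `ℚ`-semialgebraic
`Mₗ ≥ 1`, exponents `A i l : ℕ` with `Wᵢ ^ N₀ = ∏ₗ Mₗ ^ (A i l)` and `Σᵢ (A i l) hᵢ = 0` on `P`.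
Then `Σᵢ [Vᵢ] ∈ KZ.relations`: `N₀ • [Vᵢ] ∼ [{1 ≤ u ≤ Wᵢ^N₀}, hᵢ/u]` (power rule), which peels into
`Σₗ [{1 ≤ u ≤ Mₗ}, (A i l) hᵢ/u]` (`fold_of_sub_sum_mem_relations_peel`; these are honest because
`(A i l) log Mₗ ≤ N₀ log Wᵢ`), and for fixed `l` the latter sum over `i` has total integrand
`(Σᵢ A i l hᵢ)/u = 0` (iterated integrand additivity `KZ.of_sub_of_sub_sum_mem_relations`); finally
integer division `mem_relations_of_nsmul_mem_relations`. -/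
theorem fold_sum_of_mem_relations_piece {n k p : ℕ} {P : Set (Fin n → ℝ)} (hP : IsSemialgebraic ℚ P)
    {h W : Fin k → (Fin n → ℝ) → ℝ} (hh : ∀ i, IsSemialgebraicFunOn ℚ P (h i))
    (hW : ∀ i, IsSemialgebraicFunOn ℚ P (W i)) (hW1 : ∀ i, ∀ x ∈ P, 1 ≤ W i x)
    (hint : ∀ i, IntegrableOn (fun x => h i x * Real.log (W i x)) P)
    (V : Fin k → KZ.IntegralRep (n + 1))
    (hVd : ∀ i, (V i).domain = KZlog.band P (fun _ => 1) (W i))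
    (hVi : ∀ i, EqOn (V i).integrand (fun z => h i (Fin.init z) / z (Fin.last n)) (V i).domain)
    {N₀ : ℕ} (hN₀ : 0 < N₀) {M : Fin p → (Fin n → ℝ) → ℝ}
    (hM : ∀ l, IsSemialgebraicFunOn ℚ P (M l)) (hM1 : ∀ l, ∀ x ∈ P, 1 ≤ M l x)
    (A : Fin k → Fin p → ℕ) (hpow : ∀ i, ∀ x ∈ P, W i x ^ N₀ = ∏ l, M l x ^ A i l)
    (hsum : ∀ l, ∀ x ∈ P, ∑ i, (A i l : ℝ) * h i x = 0) :
    ∑ i, KZ.of (V i) ∈ KZ.relations := by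
  have hPm : MeasurableSet P := IsSemialgebraic.measurableSet_holds hP
  -- the domination `(A i l) log Mₗ ≤ N₀ log Wᵢ` on `P`
  have hkey : ∀ i l, ∀ x ∈ P, (A i l : ℝ) * Real.log (M l x) ≤ N₀ * Real.log (W i x) := by
    intro i l x hx
    have hMpos : ∀ l, 0 < M l x := fun l => one_pos.trans_le (hM1 l x hx)
    calc (A i l : ℝ) * Real.log (M l x)
        ≤ ∑ l', (A i l' : ℝ) * Real.log (M l' x) :=
          Finset.single_le_sum (f := fun l' => (A i l' : ℝ) * Real.log (M l' x))
            (fun l' _ => mul_nonneg (Nat.cast_nonneg _) (Real.log_nonneg (hM1 l' x hx)))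
            (Finset.mem_univ l)
      _ = Real.log (∏ l', M l' x ^ A i l') := by
          rw [Real.log_prod (fun l' _ => (pow_pos (hMpos l') _).ne')]
          simp [Real.log_pow]
      _ = N₀ * Real.log (W i x) := by rw [← hpow i x hx, Real.log_pow]
  -- the honest representations `[{1 ≤ u ≤ Wᵢ ^ N₀}, hᵢ/u]`
  have hWN : ∀ i, IsSemialgebraicFunOn ℚ P (fun x => W i x ^ N₀) := fun i => (hW i).fun_pow N₀
  have hWN1 : ∀ i, ∀ x ∈ P, 1 ≤ W i x ^ N₀ := fun i x hx => one_le_pow₀ (hW1 i x hx)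
  have hintN : ∀ i, IntegrableOn (fun x => h i x * Real.log (W i x ^ N₀)) P := fun i =>
    IntegrableOn.congr_fun ((hint i).const_mul (N₀ : ℝ)) (fun x _ => by rw [Real.log_pow]; ring)
      hPm
  choose Rp hRpd hRpi using fun i => fold_exists_unfoldRep hP (hh i) (hWN i) (hWN1 i) (hintN i)
  -- power rule: `[{1 ≤ u ≤ Wᵢ^N₀}, hᵢ/u] ∼ [{1 ≤ u ≤ Wᵢ}, N₀ hᵢ/u]`
  have h2 : ∀ i, KZ.of (Rp i) - KZ.of ((V i).constMul (N₀ : ℝ) (isAlgebraic_nat N₀)) ∈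
      KZ.relations := by
    intro i
    have := fold_of_sub_sum_mem_relations_peel hP 1 (fun _ => W i) (fun _ => N₀) (fun _ => hW i)
      (fun _ => hW1 i) (Rp i) (fun _ => (V i).constMul (N₀ : ℝ) (isAlgebraic_nat N₀))
      (by rw [hRpd]; exact fold_band_congr_right fun x _ => by simp) (by rw [hRpi]; exact fun _ _ => rfl)
      (fun _ => by rw [KZ.IntegralRep.domain_constMul, hVd])
      (fun _ z hz => by
        rw [KZ.IntegralRep.domain_constMul] at hz
        simp only [KZ.IntegralRep.integrand_constMul]
        rw [hVi i hz, mul_div_assoc])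
    simpa using this
  -- the honest representations `T i l = [{1 ≤ u ≤ Mₗ}, (A i l) hᵢ/u]`
  have hTsa : ∀ i l, IsSemialgebraicFunOn ℚ P (fun x => (A i l : ℝ) * h i x) := fun i l =>
    (isSemialgebraicFunOn_const_natCast hP _).fun_mul (hh i)
  have hTint : ∀ i l, IntegrableOn (fun x => (A i l : ℝ) * h i x * Real.log (M l x)) P := by
    intro i l
    refine Integrable.mono' (((hint i).norm).const_mul (N₀ : ℝ)) ?_ ?_
    · have h1 := KZ.aestronglyMeasurable_of_isSemialgebraicFunOn (hTsa i l) hPm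
      have h2 := KZ.aestronglyMeasurable_of_isSemialgebraicFunOn (hM l) hPm
      exact h1.mul (Real.measurable_log.comp_aemeasurable h2.aemeasurable).aestronglyMeasurable
    · refine (ae_restrict_mem hPm).mono fun x hx => ?_
      have hA : (0 : ℝ) ≤ A i l := Nat.cast_nonneg _
      have hlM : 0 ≤ Real.log (M l x) := Real.log_nonneg (hM1 l x hx)
      have hlW : 0 ≤ Real.log (W i x) := Real.log_nonneg (hW1 i x hx)
      rw [Real.norm_eq_abs, Real.norm_eq_abs, abs_mul, abs_mul, abs_of_nonneg hA,
        abs_of_nonneg hlM, abs_mul, abs_of_nonneg hlW]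
      calc (A i l : ℝ) * |h i x| * Real.log (M l x)
          = |h i x| * ((A i l : ℝ) * Real.log (M l x)) := by ring
        _ ≤ |h i x| * (N₀ * Real.log (W i x)) :=
          mul_le_mul_of_nonneg_left (hkey i l x hx) (abs_nonneg _)
        _ = N₀ * (|h i x| * Real.log (W i x)) := by ring
  choose T hTd hTi using fun i l => fold_exists_unfoldRep hP (hTsa i l) (hM l) (hM1 l) (hTint i l)
  -- peeling: `[{1 ≤ u ≤ Wᵢ^N₀}, hᵢ/u] ∼ Σₗ [T i l]`
  have h3 : ∀ i, KZ.of (Rp i) - ∑ l, KZ.of (T i l) ∈ KZ.relations := fun i =>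
    fold_of_sub_sum_mem_relations_peel hP p M (A i) hM hM1 (Rp i) (T i)
      (by rw [hRpd]; exact fold_band_congr_right fun x hx => hpow i x hx)
      (by rw [hRpi]; exact fun _ _ => rfl) (hTd i) (fun l => by rw [hTi]; exact fun _ _ => rfl)
  -- regrouping by `l`: `Σᵢ [T i l]` has total integrand `(Σᵢ A i l hᵢ)/u = 0`
  have h4 : ∀ l, ∑ i, KZ.of (T i l) ∈ KZ.relations := by
    intro l
    obtain ⟨Z, hZd, hZi⟩ := KZ.exists_zeroRep (n := n + 1)
      (KZlog.isSemialgebraic_band (fold_isSemialgebraicFunOn_one hP) (hM l))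
    have hrel : KZ.of Z - KZ.of Z - ∑ i, KZ.of (T i l) ∈ KZ.relations := by
      refine KZ.of_sub_of_sub_sum_mem_relations k Z Z (fun i => T i l) rfl
        (fun i => by rw [hTd, hZd]) fun z hz => ?_
      rw [hZd] at hz
      simp only [hZi, Pi.zero_apply, hTi, zero_add]
      rw [← Finset.sum_div, hsum l _ hz.1, zero_div]
    have hZ : KZ.of Z ∈ KZ.relations :=
      KZ.of_mem_relations_of_eqOn_zero Z (by rw [hZi]; exact fun _ _ => rfl)
    have : ∑ i, KZ.of (T i l) =
        KZ.of Z - KZ.of Z - (KZ.of Z - KZ.of Z - ∑ i, KZ.of (T i l)) := by abel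
    rw [this]
    exact KZ.relations.sub_mem (KZ.relations.sub_mem hZ hZ) hrel
  -- `N₀`-multiples and integer division
  have h5 : ∀ i, KZ.of ((V i).constMul (N₀ : ℝ) (isAlgebraic_nat N₀)) - N₀ • KZ.of (V i) ∈
      KZ.relations :=
    fun i => KZ.IntegralRep.of_constMul_nat_sub_nsmul_mem_relations (V i) N₀
  refine LogKernelConjectureNegative.mem_relations_of_nsmul_mem_relations hN₀ ?_
  have e : N₀ • ∑ i, KZ.of (V i) =
      ∑ i, (-(KZ.of ((V i).constMul (N₀ : ℝ) (isAlgebraic_nat N₀)) - N₀ • KZ.of (V i)) -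
        (KZ.of (Rp i) - KZ.of ((V i).constMul (N₀ : ℝ) (isAlgebraic_nat N₀))) +
        (KZ.of (Rp i) - ∑ l, KZ.of (T i l))) + ∑ l, ∑ i, KZ.of (T i l) := by
    rw [Finset.smul_sum, Finset.sum_comm, ← Finset.sum_add_distrib]
    exact Finset.sum_congr rfl fun i _ => by abel
  rw [e]
  exact KZ.relations.add_mem (AddSubgroup.sum_mem _ fun i _ => KZ.relations.add_mem
    (KZ.relations.sub_mem (KZ.relations.neg_mem (h5 i)) (h2 i)) (h3 i))
    (AddSubgroup.sum_mem _ fun l _ => h4 l)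

/-- **The fold on one cell.** Given the cone decomposition (the antecedent of `stub_cellwiseFold`),
on a `ℚ`-semialgebraic `C` with `hᵢ`, `Wᵢ ≥ 1` `ℚ`-semialgebraic, `hᵢ log Wᵢ ∈ L¹(C)`, honest
unfolded monomials `Vᵢ = [{x ∈ C, 1 ≤ u ≤ Wᵢ x}, hᵢ x/u]`, and a lattice presentation
`h = Σ_r q_r f_r` with `∏ᵢ Wᵢ ^ (f r i) = 1` on `C`: `Σᵢ [Vᵢ] ∈ KZ.relations`. The cone
decomposition of `f`, applied pointwise to `ℓ = (log Wᵢ x)ᵢ ≥ 0` (orthogonal to every `f_r` since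
`log ∏ Wᵢ^{f r i} = 0`), covers `C` by the chart pieces
`{x | W^{b a l}(x) ≥ 1 ∀ l, Wᵢ(x)^{N a} = ∏ₗ (W^{b a l}(x))^{A a i l} ∀ i}` (`ℚ`-semialgebraic;
exponentiate with `Real.log_prod`, `Real.log_zpow`, `Real.log_injOn_pos`); after disjointification,
domain additivity `KZ.of_sub_sum_of_mem_relations` splits each `[Vᵢ]` over the pieces and
`fold_sum_of_mem_relations_piece` concludes on each piece
(`Σᵢ A a i l hᵢ = Σ_r q_r Σᵢ f r i A a i l = 0`). -/
theorem fold_sum_of_mem_relations_cell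
    (hCD : ∀ (k R : ℕ) (f : Fin R → Fin k → ℤ),
      ∃ (m p : ℕ) (N : Fin m → ℕ) (b : Fin m → Fin p → Fin k → ℤ) (A : Fin m → Fin k → Fin p → ℕ),
        (∀ a, 0 < N a) ∧
        (∀ a l r, ∑ i, f r i * (A a i l : ℤ) = 0) ∧
        ∀ ℓ : Fin k → ℝ, (∀ i, 0 ≤ ℓ i) → (∀ r, ∑ i, (f r i : ℝ) * ℓ i = 0) →
          ∃ a, (∀ l, 0 ≤ ∑ i, (b a l i : ℝ) * ℓ i) ∧
            ∀ i, (N a : ℝ) * ℓ i = ∑ l, (A a i l : ℝ) * ∑ i', (b a l i' : ℝ) * ℓ i')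
    {n k : ℕ} {C : Set (Fin n → ℝ)} (hC : IsSemialgebraic ℚ C)
    {h W : Fin k → (Fin n → ℝ) → ℝ} (hh : ∀ i, IsSemialgebraicFunOn ℚ C (h i))
    (hW : ∀ i, IsSemialgebraicFunOn ℚ C (W i)) (hW1 : ∀ i, ∀ x ∈ C, 1 ≤ W i x)
    (hint : ∀ i, IntegrableOn (fun x => h i x * Real.log (W i x)) C)
    (V : Fin k → KZ.IntegralRep (n + 1))
    (hVd : ∀ i, (V i).domain = KZlog.band C (fun _ => 1) (W i))
    (hVi : ∀ i, EqOn (V i).integrand (fun z => h i (Fin.init z) / z (Fin.last n)) (V i).domain)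
    {R : ℕ} (f : Fin R → Fin k → ℤ) (q : Fin R → (Fin n → ℝ) → ℝ)
    (hprod : ∀ r, ∀ x ∈ C, ∏ i, W i x ^ (f r i) = 1)
    (hhq : ∀ i, ∀ x ∈ C, h i x = ∑ r, q r x * (f r i : ℝ)) :
    ∑ i, KZ.of (V i) ∈ KZ.relations := by
  obtain ⟨m, p, Nc, b, A, hNc, horth, hcover⟩ := hCD k R f
  have hWpos : ∀ i, ∀ x ∈ C, 0 < W i x := fun i x hx => one_pos.trans_le (hW1 i x hx)
  -- the monomials `M a l = W ^ (b a l)`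
  set M : Fin m → Fin p → (Fin n → ℝ) → ℝ := fun a l x => ∏ i, W i x ^ (b a l i) with hM_def
  have hMsa : ∀ a l, IsSemialgebraicFunOn ℚ C (M a l) := fun a l =>
    IsSemialgebraicFunOn.fun_finsetProd _ hC fun i _ => fold_fun_zpow (hW i) _
  have hMpos : ∀ a l, ∀ x ∈ C, 0 < M a l x := fun a l x hx =>
    Finset.prod_pos fun i _ => zpow_pos (hWpos i x hx) _
  have hlogM : ∀ a l, ∀ x ∈ C, Real.log (M a l x) = ∑ i, (b a l i : ℝ) * Real.log (W i x) := by
    intro a l x hx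
    simp only [hM_def]
    rw [Real.log_prod (fun i _ => (zpow_pos (hWpos i x hx) _).ne')]
    simp [Real.log_zpow]
  -- the chart pieces
  set Q : Fin m → Set (Fin n → ℝ) := fun a =>
    C ∩ (⋂ l ∈ (Finset.univ : Finset (Fin p)), {x | x ∈ C ∧ 0 ≤ M a l x - 1}) ∩
      ⋂ i ∈ (Finset.univ : Finset (Fin k)), {x | x ∈ C ∧ W i x ^ Nc a = ∏ l, M a l x ^ A a i l}
    with hQ_def
  have hQsa : ∀ a, IsSemialgebraic ℚ (Q a) := fun a =>
    (hC.inter (IsSemialgebraic.biInter _ _ fun l _ =>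
      ((hMsa a l).fun_sub (fold_isSemialgebraicFunOn_one hC)).isSemialgebraic_sep_nonneg)).inter
      (IsSemialgebraic.biInter _ _ fun i _ => isSemialgebraic_sep_eq ((hW i).fun_pow _)
        (IsSemialgebraicFunOn.fun_finsetProd _ hC fun l _ => (hMsa a l).fun_pow _))
  have hmemQ : ∀ a x, x ∈ Q a ↔
      x ∈ C ∧ (∀ l, 1 ≤ M a l x) ∧ ∀ i, W i x ^ Nc a = ∏ l, M a l x ^ A a i l := by
    intro a x
    simp only [hQ_def, mem_inter_iff, mem_iInter, mem_setOf_eq, sub_nonneg]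
    exact ⟨fun ⟨⟨hxC, h1⟩, h2⟩ => ⟨hxC, fun l => (h1 l (Finset.mem_univ l)).2,
      fun i => (h2 i (Finset.mem_univ i)).2⟩,
      fun ⟨hxC, h1, h2⟩ => ⟨⟨hxC, fun l _ => ⟨hxC, h1 l⟩⟩, fun i _ => ⟨hxC, h2 i⟩⟩⟩
  -- the pieces cover the cell
  have hQcov : ∀ x ∈ C, ∃ a, x ∈ Q a := by
    intro x hx
    obtain ⟨a, hb, hN⟩ := hcover (fun i => Real.log (W i x))
      (fun i => Real.log_nonneg (hW1 i x hx)) (fun r => by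
        have := congrArg Real.log (hprod r x hx)
        rw [Real.log_prod (fun i _ => (zpow_pos (hWpos i x hx) _).ne'), Real.log_one] at this
        simpa [Real.log_zpow] using this)
    refine ⟨a, (hmemQ a x).2 ⟨hx, fun l => ?_, fun i => ?_⟩⟩
    · exact (Real.log_nonneg_iff (hMpos a l x hx)).1 ((hlogM a l x hx).symm ▸ hb l)
    · refine Real.log_injOn_pos (mem_Ioi.2 (pow_pos (hWpos i x hx) _))
        (mem_Ioi.2 (Finset.prod_pos fun l _ => pow_pos (hMpos a l x hx) _)) ?_
      rw [Real.log_pow, Real.log_prod (fun l _ => (pow_pos (hMpos a l x hx) _).ne'), hN i]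
      refine Finset.sum_congr rfl fun l _ => ?_
      rw [Real.log_pow, hlogM a l x hx]
  -- disjointification
  set Pc : Fin m → Set (Fin n → ℝ) := fun a =>
    Q a \ ⋃ a' ∈ (Finset.univ.filter fun a' => a' < a), Q a' with hPc_def
  have hPcsa : ∀ a, IsSemialgebraic ℚ (Pc a) := fun a =>
    (hQsa a).diff (IsSemialgebraic.biUnion _ _ fun a' _ => hQsa a')
  have hmemPc : ∀ a x, x ∈ Pc a ↔ x ∈ Q a ∧ ∀ a' < a, x ∉ Q a' := by
    intro a x
    simp [hPc_def]
  have hPcQ : ∀ a, ∀ x ∈ Pc a, x ∈ Q a := fun a x hx => ((hmemPc a x).1 hx).1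
  have hPcC : ∀ a, Pc a ⊆ C := fun a x hx => ((hmemQ a x).1 (hPcQ a x hx)).1
  have hPcdisj : ∀ a a', a ≠ a' → Pc a ∩ Pc a' = ∅ := by
    intro a a' hne
    refine eq_empty_of_forall_notMem fun x hx => ?_
    rcases lt_or_gt_of_ne hne with hlt | hlt
    · exact ((hmemPc a' x).1 hx.2).2 a hlt (hPcQ a x hx.1)
    · exact ((hmemPc a x).1 hx.1).2 a' hlt (hPcQ a' x hx.2)
  have hPccov : ∀ x ∈ C, ∃ a, x ∈ Pc a := by
    intro x hx
    obtain ⟨a, ha, hmin⟩ := wellFounded_lt.has_min {a | x ∈ Q a} (hQcov x hx)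
    exact ⟨a, (hmemPc a x).2 ⟨ha, fun a' hlt ha' => hmin a' ha' hlt⟩⟩
  -- restriction of the `Vᵢ` to the pieces (domain additivity)
  have hB : ∀ i a, IsSemialgebraic ℚ (KZlog.band (Pc a) (fun _ => 1) (W i)) := fun i a =>
    KZlog.isSemialgebraic_band (fold_isSemialgebraicFunOn_one (hPcsa a))
      ((hW i).mono (hPcC a) (hPcsa a))
  have hsub : ∀ i a, KZlog.band (Pc a) (fun _ => 1) (W i) ⊆ (V i).domain := fun i a z hz => by
    rw [hVd]
    exact ⟨hPcC a hz.1, hz.2⟩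
  set Vr : Fin k → Fin m → KZ.IntegralRep (n + 1) := fun i a =>
    (V i).restrict _ (hB i a) (hsub i a) with hVr
  have hVrd : ∀ i a, (Vr i a).domain = KZlog.band (Pc a) (fun _ => 1) (W i) := fun _ _ => rfl
  have hsplit : ∀ i, KZ.of (V i) - ∑ a, KZ.of (Vr i a) ∈ KZ.relations := by
    intro i
    refine KZ.of_sub_sum_of_mem_relations Finset.univ (V i) (Vr i) (fun a _ => ?_)
      (fun a _ _ _ => rfl) ?_ ?_
    · rw [hVrd, sdiff_eq_empty.mpr (hsub i a)]
      exact measure_empty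
    · have : (V i).domain \ ⋃ a ∈ (Finset.univ : Finset (Fin m)), (Vr i a).domain = ∅ := by
        refine eq_empty_of_forall_notMem fun z hz => hz.2 ?_
        have hz1 := hz.1
        rw [hVd] at hz1
        obtain ⟨a, ha⟩ := hPccov _ hz1.1
        exact mem_iUnion₂.2 ⟨a, Finset.mem_univ a, ⟨ha, hz1.2⟩⟩
      rw [this]
      exact measure_empty
    · intro a _ a' _ hne
      rw [hVrd, hVrd, KZ.band_inter_band_eq_empty (hPcdisj a a' hne)]
      exact measure_empty
  -- the fold on each piece
  have hpiece : ∀ a, ∑ i, KZ.of (Vr i a) ∈ KZ.relations := by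
    intro a
    refine fold_sum_of_mem_relations_piece (hPcsa a) (fun i => (hh i).mono (hPcC a) (hPcsa a))
      (fun i => (hW i).mono (hPcC a) (hPcsa a)) (fun i x hx => hW1 i x (hPcC a hx))
      (fun i => (hint i).mono_set (hPcC a)) (fun i => Vr i a) (fun i => rfl)
      (fun i z hz => hVi i (hsub i a hz)) (hNc a) (fun l => (hMsa a l).mono (hPcC a) (hPcsa a))
      (fun l x hx => ((hmemQ a x).1 (hPcQ a x hx)).2.1 l) (A a)
      (fun i x hx => ((hmemQ a x).1 (hPcQ a x hx)).2.2 i) fun l x hx => ?_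
    have hxC := hPcC a hx
    have horth' : ∀ r, ∑ i, (f r i : ℝ) * (A a i l : ℝ) = 0 := fun r => by
      exact_mod_cast horth a l r
    calc ∑ i, (A a i l : ℝ) * h i x = ∑ i, ∑ r, q r x * ((f r i : ℝ) * (A a i l : ℝ)) := by
          refine Finset.sum_congr rfl fun i _ => ?_
          rw [hhq i x hxC, Finset.mul_sum]
          exact Finset.sum_congr rfl fun r _ => by ring
      _ = ∑ r, q r x * ∑ i, (f r i : ℝ) * (A a i l : ℝ) := by
          rw [Finset.sum_comm]
          simp_rw [Finset.mul_sum]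
      _ = 0 := Finset.sum_eq_zero fun r _ => by rw [horth' r, mul_zero]
  -- assembly
  have e : ∑ i, KZ.of (V i) =
      ∑ i, (KZ.of (V i) - ∑ a, KZ.of (Vr i a)) + ∑ a, ∑ i, KZ.of (Vr i a) := by
    rw [Finset.sum_sub_distrib, Finset.sum_comm, sub_add_cancel]
  rw [e]
  exact KZ.relations.add_mem (AddSubgroup.sum_mem _ fun i _ => hsplit i)
    (AddSubgroup.sum_mem _ fun a _ => hpiece a)


/-- **Cellwise fold** (registered `stub_cellwiseFold`, now fed by `ConeDecomposition`): over a
`ℚ`-semialgebraic `σ` with `W ≥ 1`, given finitely many disjoint open semialgebraic cells covering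
`σ` up to a null set, on each of which `h = Σ_r q_r f_r` with `∏ W^{f_r} ≡ 1` and `q_r`
semialgebraic, the unfolded monomials `Uᵢ = [{x ∈ σ, 1 ≤ u ≤ Wᵢ x}, hᵢ x/u]` sum to a relation.
On a cell, on the chart piece `{x | W^{b a l} ≥ 1 ∀ l, Wᵢ^{N} = ∏_l (W^{b a l})^{A i l} ∀ i}`
(semialgebraic, covering by `ConeDecomposition` applied to `ℓ = log W(x)`): power rule
`N[Uᵢ] ∼ [{1 ≤ u ≤ Wᵢ^N}, hᵢ/u]`, product rule `KZ.of_sub_of_sub_mem_relations_mul` peels the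
factors `M_l = W^{b a l} ≥ 1` (intermediate monomials dominated by `N |hᵢ| log Wᵢ`, hence
admissible), regrouping by `l` gives integrands `(Σᵢ A i l hᵢ)/u = 0`; integer division
`mem_relations_of_nsmul_mem_relations`; pieces and the null remainder by domain additivity
(`KZ.of_sub_sum_of_mem_relations`, the part of `Uᵢ` over `σ ∖ ⋃ C` being null by
`KZ.volume_setOf_init_mem_eq_zero`; `fold_sum_of_mem_relations_cell` on each cell). -/
theorem stub_cellwiseFold :
    (∀ (k R : ℕ) (f : Fin R → Fin k → ℤ),
      ∃ (m p : ℕ) (N : Fin m → ℕ) (b : Fin m → Fin p → Fin k → ℤ) (A : Fin m → Fin k → Fin p → ℕ),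
        (∀ a, 0 < N a) ∧
        (∀ a l r, ∑ i, f r i * (A a i l : ℤ) = 0) ∧
        ∀ ℓ : Fin k → ℝ, (∀ i, 0 ≤ ℓ i) → (∀ r, ∑ i, (f r i : ℝ) * ℓ i = 0) →
          ∃ a, (∀ l, 0 ≤ ∑ i, (b a l i : ℝ) * ℓ i) ∧
            ∀ i, (N a : ℝ) * ℓ i = ∑ l, (A a i l : ℝ) * ∑ i', (b a l i' : ℝ) * ℓ i') →
    ∀ (n k : ℕ) (σ : Set (Fin n → ℝ)) (h W : Fin k → (Fin n → ℝ) → ℝ)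
      (U : Fin k → KZ.IntegralRep (n + 1)) (N : ℕ) (C : Fin N → Set (Fin n → ℝ)),
      IsSemialgebraic ℚ σ → (∀ i, IsSemialgebraicFunOn ℚ σ (h i)) →
      (∀ i, IsSemialgebraicFunOn ℚ σ (W i)) → (∀ i, ∀ x ∈ σ, 1 ≤ W i x) →
      (∀ i, (U i).domain = {z | (Fin.init z : Fin n → ℝ) ∈ σ ∧ 1 ≤ z (Fin.last n) ∧
        z (Fin.last n) ≤ W i (Fin.init z)}) →
      (∀ i, EqOn (U i).integrand (fun z => h i (Fin.init z) / z (Fin.last n)) (U i).domain) →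
      (∀ i, IntegrableOn (fun x => h i x * Real.log (W i x)) σ) →
      (∀ c, IsSemialgebraic ℚ (C c) ∧ IsOpen (C c) ∧ C c ⊆ σ) →
      Pairwise (Function.onFun Disjoint C) → volume (σ \ ⋃ c, C c) = 0 →
      (∀ c, ∃ (R : ℕ) (f : Fin R → Fin k → ℤ) (q : Fin R → (Fin n → ℝ) → ℝ),
        (∀ r, IsSemialgebraicFunOn ℚ (C c) (q r)) ∧ (∀ r, ∀ x ∈ C c, ∏ i, W i x ^ (f r i) = 1) ∧
        (∀ i, ∀ x ∈ C c, h i x = ∑ r, q r x * (f r i : ℝ))) →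
      ∑ i, KZ.of (U i) ∈ KZ.relations := by
  intro hCD n k σ h W U N C hσ hh hW hW1 hUd hUi hUint hC hdisj hnull hcell
  have hCσ : ∀ c, C c ⊆ σ := fun c => (hC c).2.2
  have hCsa : ∀ c, IsSemialgebraic ℚ (C c) := fun c => (hC c).1
  -- restriction of the `Uᵢ` to the cells (domain additivity, the remainder being null)
  have hB : ∀ i c, IsSemialgebraic ℚ (KZlog.band (C c) (fun _ => 1) (W i)) := fun i c =>
    KZlog.isSemialgebraic_band (fold_isSemialgebraicFunOn_one (hCsa c))
      ((hW i).mono (hCσ c) (hCsa c))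
  have hsub : ∀ i c, KZlog.band (C c) (fun _ => 1) (W i) ⊆ (U i).domain := fun i c z hz => by
    rw [hUd]
    exact ⟨hCσ c hz.1, hz.2⟩
  set Uc : Fin k → Fin N → KZ.IntegralRep (n + 1) := fun i c =>
    (U i).restrict _ (hB i c) (hsub i c) with hUc
  have hUcd : ∀ i c, (Uc i c).domain = KZlog.band (C c) (fun _ => 1) (W i) := fun _ _ => rfl
  have hsplit : ∀ i, KZ.of (U i) - ∑ c, KZ.of (Uc i c) ∈ KZ.relations := by
    intro i
    refine KZ.of_sub_sum_of_mem_relations Finset.univ (U i) (Uc i) (fun c _ => ?_)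
      (fun c _ _ _ => rfl) ?_ ?_
    · rw [hUcd, sdiff_eq_empty.mpr (hsub i c)]
      exact measure_empty
    · refine measure_mono_null (fun z hz => ?_) (KZ.volume_setOf_init_mem_eq_zero hnull)
      have hz1 := hz.1
      rw [hUd] at hz1
      refine ⟨hz1.1, fun hU => hz.2 ?_⟩
      obtain ⟨c, hc⟩ := mem_iUnion.1 hU
      exact mem_iUnion₂.2 ⟨c, Finset.mem_univ c, ⟨hc, hz1.2⟩⟩
    · intro c _ c' _ hne
      rw [hUcd, hUcd, KZ.band_inter_band_eq_empty (Set.disjoint_iff_inter_eq_empty.1 (hdisj hne))]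
      exact measure_empty
  -- the fold on each cell
  have hcellrel : ∀ c, ∑ i, KZ.of (Uc i c) ∈ KZ.relations := by
    intro c
    obtain ⟨R, f, q, -, hprod, hhq⟩ := hcell c
    exact fold_sum_of_mem_relations_cell hCD (hCsa c)
      (fun i => (hh i).mono (hCσ c) (hCsa c)) (fun i => (hW i).mono (hCσ c) (hCsa c))
      (fun i x hx => hW1 i x (hCσ c hx)) (fun i => (hUint i).mono_set (hCσ c)) (fun i => Uc i c)
      (fun i => rfl) (fun i z hz => hUi i (hsub i c hz)) f q hprod hhq
  have e : ∑ i, KZ.of (U i) =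
      ∑ i, (KZ.of (U i) - ∑ c, KZ.of (Uc i c)) + ∑ c, ∑ i, KZ.of (Uc i c) := by
    rw [Finset.sum_sub_distrib, Finset.sum_comm, sub_add_cancel]
  rw [e]
  exact KZ.relations.add_mem (AddSubgroup.sum_mem _ fun i _ => hsplit i)
    (AddSubgroup.sum_mem _ fun c _ => hcellrel c)

end Summit.KontsevichZagierPeriods.LiouvilleUnfolding.LogPrimitiveNL
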